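import Summits.RiemannHypothesis.RiemannHypothesis.Theorems.WeilFormatCDataO102BFrontData
import Summits.RiemannHypothesis.RiemannHypothesis.Theorems.WeilFormatCDataO102BTables
import Summits.RiemannHypothesis.RiemannHypothesis.Theorems.WeilFormatCDataO102BTabValid7
import Summits.RiemannHypothesis.RiemannHypothesis.Theorems.WeilFormatCDataO102BTabValid8
import Summits.RiemannHypothesis.RiemannHypothesis.Theorems.WeilFormatCDataO102BTabValid
import Summits.RiemannHypothesis.RiemannHypothesis.Theorems.WeilFormatCDataA1RungCB
import Summits.RiemannHypothesis.RiemannHypothesis.Theorems.S2FormatCE0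
import Literature.NumberTheory.LFunctions.YoshidaWindowGramTailMSSines
import Literature.NumberTheory.LFunctions.YoshidaWindowGramMiddleJBox
import Literature.NumberTheory.LFunctions.YoshidaWindowGramTailJFactoredScaled
import Literature.NumberTheory.LFunctions.YoshidaWindowGramTailMSFactored
import Literature.NumberTheory.LFunctions.YoshidaWindowGramTailJDiagTight
import Summits.RiemannHypothesis.RiemannHypothesis.Theorems.FormatCPsdBands
import Summits.RiemannHypothesis.RiemannHypothesis.Theorems.WeilFormatCDiagShift
import HarnessLib
import Summits.RiemannHypothesis.RiemannHypothesis.Theorems.WeilFormatCDataO102BOddAsmB2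

/-!
# Format C kernel rung `O102B` (a = 51/50, column-band layout): ASSEMBLY of the flat layout, part C of 12 (ladders of TabValid7, TabValid8, TabValid; split of the 2697-line assembly at block boundaries by prover B g19 for the 400-line cap; blocks byte-identical): every propositional ladder of the kernel files (table/column validity, front door, sines, middle moments, column data, tail factors, Schur rows, (P) + diagonal shift), byte-identical statements and proofs, original order (A g22 restage_flat.py; weil-2 KERNEL-CHAIN-RULES #1)

Window `a = 51/50`; prime powers in the window: 2, 3, 2^2, 5, 7; prime constant A = 2148/1000 (`WeilFormatC.primeCoeff_form_ge_cells_v2`); evaluator parameters S = 2^320, Kpi 160, Kser 190, kred 8, Kexp 55, J 150; full table modes < 257; light column table modes < 1027; units 2^-310 (Schur entries), 2^-154 (column digits, width 157), 2^-148 (tail-factor digits, width 151), 2^-64 (reciprocal weights), 2^-40 (tail base); order-J tail J = 4, θ = 1/2048, η = 1/10 | 4/1.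
Design row: sr-gb-rung-a A g23 odd λ-run (parity cell 13 L-side): a = 51/50, μ = 2^-93, odd 256/512/1024, HIGHER precision S 2^320 c 310, MS tail, five prime powers; see HOME(A)/LADDER-CELL12-A-g23.md. Generated by sr-gb-rung-a prover A g22 with rh-explicit-weil-2 gen7's generator extended for the odd λ-run (--sector odd --mu-log2; HOME(A)/code-g22/gen7/gramgen7.py sha16 a23c13b0256hp001) from `#eval` of the tree's `Encl` functions; every datum is re-verified by the kernel in the theorem files (`decide +kernel`). Helper data of the rh-explicit Weil-positivity programme (format C, K-CELL-2), RH-free. [cite: Yoshida1992HermitianForms, §5 (5.15)-(5.16) p. 301; §7 pp. 305–312]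
-/

set_option linter.dupNamespace false
set_option exponentiation.threshold 1024
set_option maxRecDepth 200000

-- ===== from WeilFormatCDataO102BTabValid7 =====
namespace Summit.RiemannHypothesis.RiemannHypothesis.Theorems.WeilFormatCData.O102B
open Literature.NumberTheory.LFunctions Literature.NumberTheory.LFunctions.Yoshida1992 Encl Literature.Analysis.ValidatedNumerics.NumericsMP

/-- the special-value table is valid below `200` (partial). -/
theorem tabv200 : TabValid (2 ^ 320) O102B.a O102B.ks 200 O102B.tab := by
  have h170 : TabValid (2 ^ 320) a ks 170 tab := (not_not.mp tabv170b)
  have h171 : TabValid (2 ^ 320) a ks (170 + 1) tab :=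
    h170.extend fun n hn hnk ↦ idxValid_of_checkTable (prm := prm) (by norm_num [prm]) a_pos consts_valid tT170 hn hnk
  have h172 : TabValid (2 ^ 320) a ks (171 + 1) tab :=
    h171.extend fun n hn hnk ↦ idxValid_of_checkTable (prm := prm) (by norm_num [prm]) a_pos consts_valid tT171 hn hnk
  have h173 : TabValid (2 ^ 320) a ks (172 + 1) tab :=
    h172.extend fun n hn hnk ↦ idxValid_of_checkTable (prm := prm) (by norm_num [prm]) a_pos consts_valid tT172 hn hnk
  have h174 : TabValid (2 ^ 320) a ks (173 + 1) tab :=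
    h173.extend fun n hn hnk ↦ idxValid_of_checkTable (prm := prm) (by norm_num [prm]) a_pos consts_valid tT173 hn hnk
  have h175 : TabValid (2 ^ 320) a ks (174 + 1) tab :=
    h174.extend fun n hn hnk ↦ idxValid_of_checkTable (prm := prm) (by norm_num [prm]) a_pos consts_valid tT174 hn hnk
  have h176 : TabValid (2 ^ 320) a ks (175 + 1) tab :=
    h175.extend fun n hn hnk ↦ idxValid_of_checkTable (prm := prm) (by norm_num [prm]) a_pos consts_valid tT175 hn hnk
  have h177 : TabValid (2 ^ 320) a ks (176 + 1) tab :=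
    h176.extend fun n hn hnk ↦ idxValid_of_checkTable (prm := prm) (by norm_num [prm]) a_pos consts_valid tT176 hn hnk
  have h178 : TabValid (2 ^ 320) a ks (177 + 1) tab :=
    h177.extend fun n hn hnk ↦ idxValid_of_checkTable (prm := prm) (by norm_num [prm]) a_pos consts_valid tT177 hn hnk
  have h179 : TabValid (2 ^ 320) a ks (178 + 1) tab :=
    h178.extend fun n hn hnk ↦ idxValid_of_checkTable (prm := prm) (by norm_num [prm]) a_pos consts_valid tT178 hn hnk
  have h180 : TabValid (2 ^ 320) a ks (179 + 1) tab :=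
    h179.extend fun n hn hnk ↦ idxValid_of_checkTable (prm := prm) (by norm_num [prm]) a_pos consts_valid tT179 hn hnk
  have h181 : TabValid (2 ^ 320) a ks (180 + 1) tab :=
    h180.extend fun n hn hnk ↦ idxValid_of_checkTable (prm := prm) (by norm_num [prm]) a_pos consts_valid tT180 hn hnk
  have h182 : TabValid (2 ^ 320) a ks (181 + 1) tab :=
    h181.extend fun n hn hnk ↦ idxValid_of_checkTable (prm := prm) (by norm_num [prm]) a_pos consts_valid tT181 hn hnk
  have h183 : TabValid (2 ^ 320) a ks (182 + 1) tab :=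
    h182.extend fun n hn hnk ↦ idxValid_of_checkTable (prm := prm) (by norm_num [prm]) a_pos consts_valid tT182 hn hnk
  have h184 : TabValid (2 ^ 320) a ks (183 + 1) tab :=
    h183.extend fun n hn hnk ↦ idxValid_of_checkTable (prm := prm) (by norm_num [prm]) a_pos consts_valid tT183 hn hnk
  have h185 : TabValid (2 ^ 320) a ks (184 + 1) tab :=
    h184.extend fun n hn hnk ↦ idxValid_of_checkTable (prm := prm) (by norm_num [prm]) a_pos consts_valid tT184 hn hnk
  have h186 : TabValid (2 ^ 320) a ks (185 + 1) tab :=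
    h185.extend fun n hn hnk ↦ idxValid_of_checkTable (prm := prm) (by norm_num [prm]) a_pos consts_valid tT185 hn hnk
  have h187 : TabValid (2 ^ 320) a ks (186 + 1) tab :=
    h186.extend fun n hn hnk ↦ idxValid_of_checkTable (prm := prm) (by norm_num [prm]) a_pos consts_valid tT186 hn hnk
  have h188 : TabValid (2 ^ 320) a ks (187 + 1) tab :=
    h187.extend fun n hn hnk ↦ idxValid_of_checkTable (prm := prm) (by norm_num [prm]) a_pos consts_valid tT187 hn hnk
  have h189 : TabValid (2 ^ 320) a ks (188 + 1) tab :=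
    h188.extend fun n hn hnk ↦ idxValid_of_checkTable (prm := prm) (by norm_num [prm]) a_pos consts_valid tT188 hn hnk
  have h190 : TabValid (2 ^ 320) a ks (189 + 1) tab :=
    h189.extend fun n hn hnk ↦ idxValid_of_checkTable (prm := prm) (by norm_num [prm]) a_pos consts_valid tT189 hn hnk
  have h191 : TabValid (2 ^ 320) a ks (190 + 1) tab :=
    h190.extend fun n hn hnk ↦ idxValid_of_checkTable (prm := prm) (by norm_num [prm]) a_pos consts_valid tT190 hn hnk
  have h192 : TabValid (2 ^ 320) a ks (191 + 1) tab :=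
    h191.extend fun n hn hnk ↦ idxValid_of_checkTable (prm := prm) (by norm_num [prm]) a_pos consts_valid tT191 hn hnk
  have h193 : TabValid (2 ^ 320) a ks (192 + 1) tab :=
    h192.extend fun n hn hnk ↦ idxValid_of_checkTable (prm := prm) (by norm_num [prm]) a_pos consts_valid tT192 hn hnk
  have h194 : TabValid (2 ^ 320) a ks (193 + 1) tab :=
    h193.extend fun n hn hnk ↦ idxValid_of_checkTable (prm := prm) (by norm_num [prm]) a_pos consts_valid tT193 hn hnk
  have h195 : TabValid (2 ^ 320) a ks (194 + 1) tab :=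
    h194.extend fun n hn hnk ↦ idxValid_of_checkTable (prm := prm) (by norm_num [prm]) a_pos consts_valid tT194 hn hnk
  have h196 : TabValid (2 ^ 320) a ks (195 + 1) tab :=
    h195.extend fun n hn hnk ↦ idxValid_of_checkTable (prm := prm) (by norm_num [prm]) a_pos consts_valid tT195 hn hnk
  have h197 : TabValid (2 ^ 320) a ks (196 + 1) tab :=
    h196.extend fun n hn hnk ↦ idxValid_of_checkTable (prm := prm) (by norm_num [prm]) a_pos consts_valid tT196 hn hnk
  have h198 : TabValid (2 ^ 320) a ks (197 + 1) tab :=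
    h197.extend fun n hn hnk ↦ idxValid_of_checkTable (prm := prm) (by norm_num [prm]) a_pos consts_valid tT197 hn hnk
  have h199 : TabValid (2 ^ 320) a ks (198 + 1) tab :=
    h198.extend fun n hn hnk ↦ idxValid_of_checkTable (prm := prm) (by norm_num [prm]) a_pos consts_valid tT198 hn hnk
  have h200 : TabValid (2 ^ 320) a ks (199 + 1) tab :=
    h199.extend fun n hn hnk ↦ idxValid_of_checkTable (prm := prm) (by norm_num [prm]) a_pos consts_valid tT199 hn hnk
  exact h200

end Summit.RiemannHypothesis.RiemannHypothesis.Theorems.WeilFormatCData.O102B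

-- ===== from WeilFormatCDataO102BTabValid8 =====
namespace Summit.RiemannHypothesis.RiemannHypothesis.Theorems.WeilFormatCData.O102B
open Literature.NumberTheory.LFunctions Literature.NumberTheory.LFunctions.Yoshida1992 Encl Literature.Analysis.ValidatedNumerics.NumericsMP

/-- the special-value table is valid below `230` (partial). -/
theorem tabv230 : TabValid (2 ^ 320) O102B.a O102B.ks 230 O102B.tab := by
  have h200 : TabValid (2 ^ 320) a ks 200 tab := tabv200
  have h201 : TabValid (2 ^ 320) a ks (200 + 1) tab :=
    h200.extend fun n hn hnk ↦ idxValid_of_checkTable (prm := prm) (by norm_num [prm]) a_pos consts_valid tT200 hn hnk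
  have h202 : TabValid (2 ^ 320) a ks (201 + 1) tab :=
    h201.extend fun n hn hnk ↦ idxValid_of_checkTable (prm := prm) (by norm_num [prm]) a_pos consts_valid tT201 hn hnk
  have h203 : TabValid (2 ^ 320) a ks (202 + 1) tab :=
    h202.extend fun n hn hnk ↦ idxValid_of_checkTable (prm := prm) (by norm_num [prm]) a_pos consts_valid tT202 hn hnk
  have h204 : TabValid (2 ^ 320) a ks (203 + 1) tab :=
    h203.extend fun n hn hnk ↦ idxValid_of_checkTable (prm := prm) (by norm_num [prm]) a_pos consts_valid tT203 hn hnk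
  have h205 : TabValid (2 ^ 320) a ks (204 + 1) tab :=
    h204.extend fun n hn hnk ↦ idxValid_of_checkTable (prm := prm) (by norm_num [prm]) a_pos consts_valid tT204 hn hnk
  have h206 : TabValid (2 ^ 320) a ks (205 + 1) tab :=
    h205.extend fun n hn hnk ↦ idxValid_of_checkTable (prm := prm) (by norm_num [prm]) a_pos consts_valid tT205 hn hnk
  have h207 : TabValid (2 ^ 320) a ks (206 + 1) tab :=
    h206.extend fun n hn hnk ↦ idxValid_of_checkTable (prm := prm) (by norm_num [prm]) a_pos consts_valid tT206 hn hnk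
  have h208 : TabValid (2 ^ 320) a ks (207 + 1) tab :=
    h207.extend fun n hn hnk ↦ idxValid_of_checkTable (prm := prm) (by norm_num [prm]) a_pos consts_valid tT207 hn hnk
  have h209 : TabValid (2 ^ 320) a ks (208 + 1) tab :=
    h208.extend fun n hn hnk ↦ idxValid_of_checkTable (prm := prm) (by norm_num [prm]) a_pos consts_valid tT208 hn hnk
  have h210 : TabValid (2 ^ 320) a ks (209 + 1) tab :=
    h209.extend fun n hn hnk ↦ idxValid_of_checkTable (prm := prm) (by norm_num [prm]) a_pos consts_valid tT209 hn hnk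
  have h211 : TabValid (2 ^ 320) a ks (210 + 1) tab :=
    h210.extend fun n hn hnk ↦ idxValid_of_checkTable (prm := prm) (by norm_num [prm]) a_pos consts_valid tT210 hn hnk
  have h212 : TabValid (2 ^ 320) a ks (211 + 1) tab :=
    h211.extend fun n hn hnk ↦ idxValid_of_checkTable (prm := prm) (by norm_num [prm]) a_pos consts_valid tT211 hn hnk
  have h213 : TabValid (2 ^ 320) a ks (212 + 1) tab :=
    h212.extend fun n hn hnk ↦ idxValid_of_checkTable (prm := prm) (by norm_num [prm]) a_pos consts_valid tT212 hn hnk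
  have h214 : TabValid (2 ^ 320) a ks (213 + 1) tab :=
    h213.extend fun n hn hnk ↦ idxValid_of_checkTable (prm := prm) (by norm_num [prm]) a_pos consts_valid tT213 hn hnk
  have h215 : TabValid (2 ^ 320) a ks (214 + 1) tab :=
    h214.extend fun n hn hnk ↦ idxValid_of_checkTable (prm := prm) (by norm_num [prm]) a_pos consts_valid tT214 hn hnk
  have h216 : TabValid (2 ^ 320) a ks (215 + 1) tab :=
    h215.extend fun n hn hnk ↦ idxValid_of_checkTable (prm := prm) (by norm_num [prm]) a_pos consts_valid tT215 hn hnk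
  have h217 : TabValid (2 ^ 320) a ks (216 + 1) tab :=
    h216.extend fun n hn hnk ↦ idxValid_of_checkTable (prm := prm) (by norm_num [prm]) a_pos consts_valid tT216 hn hnk
  have h218 : TabValid (2 ^ 320) a ks (217 + 1) tab :=
    h217.extend fun n hn hnk ↦ idxValid_of_checkTable (prm := prm) (by norm_num [prm]) a_pos consts_valid tT217 hn hnk
  have h219 : TabValid (2 ^ 320) a ks (218 + 1) tab :=
    h218.extend fun n hn hnk ↦ idxValid_of_checkTable (prm := prm) (by norm_num [prm]) a_pos consts_valid tT218 hn hnk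
  have h220 : TabValid (2 ^ 320) a ks (219 + 1) tab :=
    h219.extend fun n hn hnk ↦ idxValid_of_checkTable (prm := prm) (by norm_num [prm]) a_pos consts_valid tT219 hn hnk
  have h221 : TabValid (2 ^ 320) a ks (220 + 1) tab :=
    h220.extend fun n hn hnk ↦ idxValid_of_checkTable (prm := prm) (by norm_num [prm]) a_pos consts_valid tT220 hn hnk
  have h222 : TabValid (2 ^ 320) a ks (221 + 1) tab :=
    h221.extend fun n hn hnk ↦ idxValid_of_checkTable (prm := prm) (by norm_num [prm]) a_pos consts_valid tT221 hn hnk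
  have h223 : TabValid (2 ^ 320) a ks (222 + 1) tab :=
    h222.extend fun n hn hnk ↦ idxValid_of_checkTable (prm := prm) (by norm_num [prm]) a_pos consts_valid tT222 hn hnk
  have h224 : TabValid (2 ^ 320) a ks (223 + 1) tab :=
    h223.extend fun n hn hnk ↦ idxValid_of_checkTable (prm := prm) (by norm_num [prm]) a_pos consts_valid tT223 hn hnk
  have h225 : TabValid (2 ^ 320) a ks (224 + 1) tab :=
    h224.extend fun n hn hnk ↦ idxValid_of_checkTable (prm := prm) (by norm_num [prm]) a_pos consts_valid tT224 hn hnk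
  have h226 : TabValid (2 ^ 320) a ks (225 + 1) tab :=
    h225.extend fun n hn hnk ↦ idxValid_of_checkTable (prm := prm) (by norm_num [prm]) a_pos consts_valid tT225 hn hnk
  have h227 : TabValid (2 ^ 320) a ks (226 + 1) tab :=
    h226.extend fun n hn hnk ↦ idxValid_of_checkTable (prm := prm) (by norm_num [prm]) a_pos consts_valid tT226 hn hnk
  have h228 : TabValid (2 ^ 320) a ks (227 + 1) tab :=
    h227.extend fun n hn hnk ↦ idxValid_of_checkTable (prm := prm) (by norm_num [prm]) a_pos consts_valid tT227 hn hnk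
  have h229 : TabValid (2 ^ 320) a ks (228 + 1) tab :=
    h228.extend fun n hn hnk ↦ idxValid_of_checkTable (prm := prm) (by norm_num [prm]) a_pos consts_valid tT228 hn hnk
  have h230 : TabValid (2 ^ 320) a ks (229 + 1) tab :=
    h229.extend fun n hn hnk ↦ idxValid_of_checkTable (prm := prm) (by norm_num [prm]) a_pos consts_valid tT229 hn hnk
  exact h230

end Summit.RiemannHypothesis.RiemannHypothesis.Theorems.WeilFormatCData.O102B

-- ===== from WeilFormatCDataO102BTabValid =====
namespace Summit.RiemannHypothesis.RiemannHypothesis.Theorems.WeilFormatCData.O102B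
open Literature.NumberTheory.LFunctions Literature.NumberTheory.LFunctions.Yoshida1992 Encl Literature.Analysis.ValidatedNumerics.NumericsMP

/-- the special-value table is valid below `257`. -/
theorem tab_valid : TabValid (2 ^ 320) O102B.a O102B.ks 257 O102B.tab := by
  have h230 : TabValid (2 ^ 320) a ks 230 tab := tabv230
  have h231 : TabValid (2 ^ 320) a ks (230 + 1) tab :=
    h230.extend fun n hn hnk ↦ idxValid_of_checkTable (prm := prm) (by norm_num [prm]) a_pos consts_valid tT230 hn hnk
  have h232 : TabValid (2 ^ 320) a ks (231 + 1) tab :=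
    h231.extend fun n hn hnk ↦ idxValid_of_checkTable (prm := prm) (by norm_num [prm]) a_pos consts_valid tT231 hn hnk
  have h233 : TabValid (2 ^ 320) a ks (232 + 1) tab :=
    h232.extend fun n hn hnk ↦ idxValid_of_checkTable (prm := prm) (by norm_num [prm]) a_pos consts_valid tT232 hn hnk
  have h234 : TabValid (2 ^ 320) a ks (233 + 1) tab :=
    h233.extend fun n hn hnk ↦ idxValid_of_checkTable (prm := prm) (by norm_num [prm]) a_pos consts_valid tT233 hn hnk
  have h235 : TabValid (2 ^ 320) a ks (234 + 1) tab :=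
    h234.extend fun n hn hnk ↦ idxValid_of_checkTable (prm := prm) (by norm_num [prm]) a_pos consts_valid tT234 hn hnk
  have h236 : TabValid (2 ^ 320) a ks (235 + 1) tab :=
    h235.extend fun n hn hnk ↦ idxValid_of_checkTable (prm := prm) (by norm_num [prm]) a_pos consts_valid tT235 hn hnk
  have h237 : TabValid (2 ^ 320) a ks (236 + 1) tab :=
    h236.extend fun n hn hnk ↦ idxValid_of_checkTable (prm := prm) (by norm_num [prm]) a_pos consts_valid tT236 hn hnk
  have h238 : TabValid (2 ^ 320) a ks (237 + 1) tab :=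
    h237.extend fun n hn hnk ↦ idxValid_of_checkTable (prm := prm) (by norm_num [prm]) a_pos consts_valid tT237 hn hnk
  have h239 : TabValid (2 ^ 320) a ks (238 + 1) tab :=
    h238.extend fun n hn hnk ↦ idxValid_of_checkTable (prm := prm) (by norm_num [prm]) a_pos consts_valid tT238 hn hnk
  have h240 : TabValid (2 ^ 320) a ks (239 + 1) tab :=
    h239.extend fun n hn hnk ↦ idxValid_of_checkTable (prm := prm) (by norm_num [prm]) a_pos consts_valid tT239 hn hnk
  have h241 : TabValid (2 ^ 320) a ks (240 + 1) tab :=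
    h240.extend fun n hn hnk ↦ idxValid_of_checkTable (prm := prm) (by norm_num [prm]) a_pos consts_valid tT240 hn hnk
  have h242 : TabValid (2 ^ 320) a ks (241 + 1) tab :=
    h241.extend fun n hn hnk ↦ idxValid_of_checkTable (prm := prm) (by norm_num [prm]) a_pos consts_valid tT241 hn hnk
  have h243 : TabValid (2 ^ 320) a ks (242 + 1) tab :=
    h242.extend fun n hn hnk ↦ idxValid_of_checkTable (prm := prm) (by norm_num [prm]) a_pos consts_valid tT242 hn hnk
  have h244 : TabValid (2 ^ 320) a ks (243 + 1) tab :=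
    h243.extend fun n hn hnk ↦ idxValid_of_checkTable (prm := prm) (by norm_num [prm]) a_pos consts_valid tT243 hn hnk
  have h245 : TabValid (2 ^ 320) a ks (244 + 1) tab :=
    h244.extend fun n hn hnk ↦ idxValid_of_checkTable (prm := prm) (by norm_num [prm]) a_pos consts_valid tT244 hn hnk
  have h246 : TabValid (2 ^ 320) a ks (245 + 1) tab :=
    h245.extend fun n hn hnk ↦ idxValid_of_checkTable (prm := prm) (by norm_num [prm]) a_pos consts_valid tT245 hn hnk
  have h247 : TabValid (2 ^ 320) a ks (246 + 1) tab :=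
    h246.extend fun n hn hnk ↦ idxValid_of_checkTable (prm := prm) (by norm_num [prm]) a_pos consts_valid tT246 hn hnk
  have h248 : TabValid (2 ^ 320) a ks (247 + 1) tab :=
    h247.extend fun n hn hnk ↦ idxValid_of_checkTable (prm := prm) (by norm_num [prm]) a_pos consts_valid tT247 hn hnk
  have h249 : TabValid (2 ^ 320) a ks (248 + 1) tab :=
    h248.extend fun n hn hnk ↦ idxValid_of_checkTable (prm := prm) (by norm_num [prm]) a_pos consts_valid tT248 hn hnk
  have h250 : TabValid (2 ^ 320) a ks (249 + 1) tab :=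
    h249.extend fun n hn hnk ↦ idxValid_of_checkTable (prm := prm) (by norm_num [prm]) a_pos consts_valid tT249 hn hnk
  have h251 : TabValid (2 ^ 320) a ks (250 + 1) tab :=
    h250.extend fun n hn hnk ↦ idxValid_of_checkTable (prm := prm) (by norm_num [prm]) a_pos consts_valid tT250 hn hnk
  have h252 : TabValid (2 ^ 320) a ks (251 + 1) tab :=
    h251.extend fun n hn hnk ↦ idxValid_of_checkTable (prm := prm) (by norm_num [prm]) a_pos consts_valid tT251 hn hnk
  have h253 : TabValid (2 ^ 320) a ks (252 + 1) tab :=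
    h252.extend fun n hn hnk ↦ idxValid_of_checkTable (prm := prm) (by norm_num [prm]) a_pos consts_valid tT252 hn hnk
  have h254 : TabValid (2 ^ 320) a ks (253 + 1) tab :=
    h253.extend fun n hn hnk ↦ idxValid_of_checkTable (prm := prm) (by norm_num [prm]) a_pos consts_valid tT253 hn hnk
  have h255 : TabValid (2 ^ 320) a ks (254 + 1) tab :=
    h254.extend fun n hn hnk ↦ idxValid_of_checkTable (prm := prm) (by norm_num [prm]) a_pos consts_valid tT254 hn hnk
  have h256 : TabValid (2 ^ 320) a ks (255 + 1) tab :=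
    h255.extend fun n hn hnk ↦ idxValid_of_checkTable (prm := prm) (by norm_num [prm]) a_pos consts_valid tT255 hn hnk
  have h257 : TabValid (2 ^ 320) a ks (256 + 1) tab :=
    h256.extend fun n hn hnk ↦ idxValid_of_checkTable (prm := prm) (by norm_num [prm]) a_pos consts_valid tT256 hn hnk
  exact h257

/-- full table for the odd rows. -/
theorem tab_valid_odd : TabValid (2 ^ 320) O102B.a O102B.ks (256 + 1) O102B.tab := fun n hn ↦ tab_valid n (by omega)

end Summit.RiemannHypothesis.RiemannHypothesis.Theorems.WeilFormatCData.O102B
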